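import Mathlib
import Literature.Geometry.DiscreteGeometry.KissingFanTriangleSets
import Literature.Geometry.DiscreteGeometry.SphericalExcessMonotone
import Literature.Geometry.DiscreteGeometry.SphericalCodeHullEuler
import Summits.AtomisticToContinuum.Crystallization.Theorems.GappedShellCensusShellTrichotomyStubBondHullEdge
import Summits.AtomisticToContinuum.Crystallization.Theorems.GappedShellCensusFiveFoldRationingRStubFfrCensus5Aux1

/-!
# Crux `GappedShellCensus.FiveFoldRationingR` (stmt-AtomisticToContinuum-18071), line `Sketch` —
# helper for stub `stub_ffrCensus5` (Aux2 = registered sub-goal `stub_ffrC5NoIcos`): the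
# icosahedron kill

**No gapped twelve-shell has all shell-degrees five.**  For `t : Fin 12 → ℝ³` with norms in
`[0.98, 1.02]`, pairwise distances `≥ 0.98` and each pair a bond (`≤ 1.02`) or far (`≥ 1.26`), it
is impossible that every point has exactly five bonded partners (the icosahedral link type of the
capped census; onset of icosahedral shells is `(1+τ)/(1−τ) = 1/sin 72°`, `τ ≈ 2.5 %`).

## Proof (area, via the node equation of the fan triangulation and Euler's excess formula)

Let `u k = t k/‖t k‖` and `X = {u k}` (twelve unit vectors; `0 ∈ interior (conv X)` by
`stub_ffrC5Interior`, Aux1).  The tree's fan triangulation `fanTriSets X` has `20` triangles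
(`card_fanTriSets`), and every bond `{u k, u l}` is a hull edge (`stub_bondHullEdge`: the other
directions have `⟪u k, y⟫ + ⟪u l, y⟫ ≤ 2 · 0.5385 < 1 + 0.4583 ≤ 1 + ⟪u k, u l⟫`), hence a side of
exactly two fan triangles (`card_filter_fanTriSets_eq_two_of_mem_hullEdges`).  Double counting the
flags (triangle, ordered bonded pair of its vertices): by the bonds there are `2 · 60 = 120` of
them (sixty ordered bonds when all degrees are five), by the triangles at most `6` each, so EVERY
fan triangle has all three sides bonded.  For such a triangle `{a, b, c}` the side cosines lie in
`[2201/4802, 2801/5202]`, so by Euler's formula (`one_sub_cos_sphExcess`)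
`1 − cos E = F(x, y, z) ≤ F(x₀, x₀, x₀) < 19/100 < 1 − cos (π/5)` (`F` = `eulerF` is decreasing in
each side cosine on this box, `eulerF_sub_eulerF`), and `E < π/2` (all three corners are acute:
`⟪b, c⟫ − ⟪a, b⟫⟪a, c⟫ > 0`), whence the excess `E < π/5`.  But the node equation
(`sum_triAngleAt`: the angles at each of the twelve directions sum to `2π`) summed over `X` and
re-summed over the triangles gives `Σ_T (π + E_T) = 24π`, i.e. `Σ_T E_T = 4π = 20 · π/5` —
contradiction.
-/

noncomputable section

namespace Summit.AtomisticToContinuum.Crystallization.Theorems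

open scoped RealInnerProductSpace
open Real InnerProductGeometry Literature.Geometry.DiscreteGeometry

/-! ### Numerics: Euler's function on the bond box -/

/-- One monotonicity step: on the bond box Euler's function decreases in its last variable.
[folklore] -/
theorem ffrC5I_eulerF_step {x y z₁ z₂ : ℝ} (hx : 2201 / 4802 ≤ x) (hx' : x ≤ 2801 / 5202)
    (hy : 2201 / 4802 ≤ y) (hy' : y ≤ 2801 / 5202) (hz₁ : 2201 / 4802 ≤ z₁) (h12 : z₁ ≤ z₂) :
    eulerF x y z₂ ≤ eulerF x y z₁ := by
  have h := eulerF_sub_eulerF (x := x) (y := y) (z₁ := z₁) (z₂ := z₂) (by linarith) (by linarith)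
    (by linarith) (by linarith)
  have hsq : (x + y) ^ 2 ≤ (2801 / 5202 + 2801 / 5202) ^ 2 :=
    pow_le_pow_left₀ (by linarith) (add_le_add hx' hy') 2
  have hpr : (1 + 2201 / 4802 : ℝ) * (1 + 2201 / 4802) ≤ (1 + z₁) * (1 + z₂) :=
    mul_le_mul (by linarith) (by linarith) (by norm_num) (by linarith)
  have hnum : (z₂ - z₁) * ((x + y) ^ 2 - (1 + z₁) * (1 + z₂)) ≤ 0 :=
    mul_nonpos_iff.2 (Or.inl ⟨by linarith, by nlinarith⟩)
  have hden : 0 < (1 + x) * (1 + y) * (1 + z₁) * (1 + z₂) :=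
    mul_pos (mul_pos (mul_pos (by linarith) (by linarith)) (by linarith)) (by linarith)
  have hle : eulerF x y z₂ - eulerF x y z₁ ≤ 0 := by
    rw [h]
    exact div_nonpos_iff.2 (Or.inr ⟨hnum, hden.le⟩)
  linarith

/-- On the bond box `[2201/4802, 2801/5202]³` Euler's function is largest at the corner of the
smallest cosines (the largest equilateral bonded triangle). [folklore] -/
theorem ffrC5I_eulerF_le {x y z : ℝ} (hx : 2201 / 4802 ≤ x) (hx' : x ≤ 2801 / 5202)
    (hy : 2201 / 4802 ≤ y) (hy' : y ≤ 2801 / 5202) (hz : 2201 / 4802 ≤ z) :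
    eulerF x y z ≤ eulerF (2201 / 4802) (2201 / 4802) (2201 / 4802) := by
  have h0 : (2201 / 4802 : ℝ) ≤ 2801 / 5202 := by norm_num
  calc eulerF x y z ≤ eulerF x y (2201 / 4802) := ffrC5I_eulerF_step hx hx' hy hy' le_rfl hz
    _ = eulerF (2201 / 4802) x y := eulerF_rotate _ _ _
    _ ≤ eulerF (2201 / 4802) x (2201 / 4802) := ffrC5I_eulerF_step le_rfl h0 hx hx' le_rfl hy
    _ = eulerF (2201 / 4802) (2201 / 4802) x := eulerF_rotate _ _ _
    _ ≤ eulerF (2201 / 4802) (2201 / 4802) (2201 / 4802) :=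
        ffrC5I_eulerF_step le_rfl h0 le_rfl h0 le_rfl hx

/-- The corner value is below `19/100` (it is `≈ 0.1813`). [folklore] -/
theorem ffrC5I_eulerF_corner_lt :
    eulerF (2201 / 4802) (2201 / 4802) (2201 / 4802) < 19 / 100 := by
  rw [eulerF_def, eulerGram_def]
  norm_num

/-- `19/100 < 1 − cos (π/5) = (3 − √5)/4 ≈ 0.19098`. [folklore] -/
theorem ffrC5I_lt_one_sub_cos_pi_div_five : (19 / 100 : ℝ) < 1 - Real.cos (π / 5) := by
  rw [Real.cos_pi_div_five]
  nlinarith [Real.sq_sqrt (show (0 : ℝ) ≤ 5 by norm_num), Real.sqrt_nonneg 5]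

/-- On the bond box the Gram determinant is positive (`≥ 0.396`). [folklore] -/
theorem ffrC5I_eulerGram_pos {x y z : ℝ} (hx : 2201 / 4802 ≤ x) (hx' : x ≤ 2801 / 5202)
    (hy : 2201 / 4802 ≤ y) (hy' : y ≤ 2801 / 5202) (hz : 2201 / 4802 ≤ z) (hz' : z ≤ 2801 / 5202) :
    0 < eulerGram x y z := by
  have hy2 : y ^ 2 ≤ (2801 / 5202 : ℝ) ^ 2 := pow_le_pow_left₀ (by linarith) hy' 2
  have hz2 : z ^ 2 ≤ (2801 / 5202 : ℝ) ^ 2 := pow_le_pow_left₀ (by linarith) hz' 2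
  have h3 : (1 - (2801 / 5202 : ℝ) ^ 2) * (1 - (2801 / 5202) ^ 2) ≤ (1 - y ^ 2) * (1 - z ^ 2) :=
    mul_le_mul (by linarith) (by linarith) (by norm_num) (by linarith)
  have hyz : y * z ≤ 2801 / 5202 * (2801 / 5202) := mul_le_mul hy' hz' (by linarith) (by norm_num)
  have hyz' : 2201 / 4802 * (2201 / 4802) ≤ y * z := mul_le_mul hy hz (by norm_num) (by linarith)
  have h5 : 0 ≤ x - y * z := by linarith
  have h4 : x - y * z ≤ 2801 / 5202 - 2201 / 4802 * (2201 / 4802) := by linarith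
  have h6 : (x - y * z) ^ 2 ≤ (2801 / 5202 - 2201 / 4802 * (2201 / 4802) : ℝ) ^ 2 :=
    pow_le_pow_left₀ h5 h4 2
  have key : eulerGram x y z = (1 - y ^ 2) * (1 - z ^ 2) - (x - y * z) ^ 2 := by
    rw [eulerGram_def]; ring
  rw [key]
  nlinarith

/-! ### One bonded spherical triangle: acute corners, excess below `π/5` -/

/-- A corner of a bonded triangle of directions is acute: `⟪b, c⟫ − ⟪a, b⟫⟪a, c⟫ > 0`.
[folklore] -/
theorem ffrC5I_angle_lt_pi_div_two {a b c : EuclideanSpace ℝ (Fin 3)} (ha : ‖a‖ = 1)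
    (hab : ⟪a, b⟫ ≤ 2801 / 5202) (hac : ⟪a, c⟫ ≤ 2801 / 5202) (hac0 : 0 ≤ ⟪a, c⟫)
    (hbc : 2201 / 4802 ≤ ⟪b, c⟫) :
    angle (perpTo a b) (perpTo a c) < π / 2 := by
  have h := cos_angle_perpTo_mul ha b c
  have hpos : 0 < ⟪b, c⟫ - ⟪a, b⟫ * ⟪a, c⟫ := by nlinarith
  by_contra hge
  push Not at hge
  have hcos : Real.cos (angle (perpTo a b) (perpTo a c)) ≤ 0 :=
    Real.cos_nonpos_of_pi_div_two_le_of_le hge (by linarith [angle_le_pi (perpTo a b) (perpTo a c)])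
  have : Real.cos (angle (perpTo a b) (perpTo a c)) * (‖perpTo a b‖ * ‖perpTo a c‖) ≤ 0 :=
    mul_nonpos_iff.2 (Or.inr ⟨hcos, by positivity⟩)
  linarith

/-- **A bonded spherical triangle has excess `< π/5`.**  For unit vectors `a, b, c` with pairwise
inner products in the bond window `[2201/4802, 2801/5202]`: the corners are acute, so the excess
`E < π/2`, and Euler's formula gives `1 − cos E = F ≤ F(corner) < 19/100 < 1 − cos (π/5)`.
[folklore] -/
theorem ffrC5I_sphExcess_lt {a b c : EuclideanSpace ℝ (Fin 3)} (ha : ‖a‖ = 1) (hb : ‖b‖ = 1)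
    (hc : ‖c‖ = 1)
    (hab : 2201 / 4802 ≤ ⟪a, b⟫ ∧ ⟪a, b⟫ ≤ 2801 / 5202)
    (hac : 2201 / 4802 ≤ ⟪a, c⟫ ∧ ⟪a, c⟫ ≤ 2801 / 5202)
    (hbc : 2201 / 4802 ≤ ⟪b, c⟫ ∧ ⟪b, c⟫ ≤ 2801 / 5202) :
    sphExcess a b c < π / 5 := by
  have hba : ⟪b, a⟫ = ⟪a, b⟫ := real_inner_comm a b
  have hca : ⟪c, a⟫ = ⟪a, c⟫ := real_inner_comm a c
  have hcb : ⟪c, b⟫ = ⟪b, c⟫ := real_inner_comm b c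
  -- linear independence from the Gram determinant
  have hgram : orient3 a b c ^ 2 = eulerGram ⟪b, c⟫ ⟪a, c⟫ ⟪a, b⟫ := by
    rw [orient3_sq_eq_gram, eulerGram_def, real_inner_self_eq_norm_sq, real_inner_self_eq_norm_sq,
      real_inner_self_eq_norm_sq, ha, hb, hc, hca]
    ring
  have hG : 0 < eulerGram ⟪b, c⟫ ⟪a, c⟫ ⟪a, b⟫ :=
    ffrC5I_eulerGram_pos hbc.1 hbc.2 hac.1 hac.2 hab.1 hab.2
  have hor : orient3 a b c ≠ 0 := by
    intro h0
    rw [h0] at hgram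
    norm_num at hgram
    linarith
  have hli : LinearIndependent ℝ ![a, b, c] := linearIndependent_of_orient3_ne_zero hor
  -- `E < π/2`
  have hA := ffrC5I_angle_lt_pi_div_two ha hab.2 hac.2 (by linarith [hac.1]) hbc.1
  have hB : angle (perpTo b a) (perpTo b c) < π / 2 :=
    ffrC5I_angle_lt_pi_div_two hb (by linarith [hab.2]) hbc.2 (by linarith [hbc.1]) hac.1
  have hC : angle (perpTo c a) (perpTo c b) < π / 2 :=
    ffrC5I_angle_lt_pi_div_two hc (by linarith [hac.2]) (by linarith [hbc.2]) (by linarith [hbc.1])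
      hab.1
  have hE2 : sphExcess a b c < π / 2 := by rw [sphExcess_def]; linarith
  -- Euler's formula
  have heul := one_sub_cos_sphExcess ha hb hc hli
  have hF : eulerF ⟪b, c⟫ ⟪a, c⟫ ⟪a, b⟫ < 1 - Real.cos (π / 5) :=
    lt_of_le_of_lt (ffrC5I_eulerF_le hbc.1 hbc.2 hac.1 hac.2 hab.1)
      (ffrC5I_eulerF_corner_lt.trans ffrC5I_lt_one_sub_cos_pi_div_five)
  by_contra hge
  push Not at hge
  have hcos : Real.cos (sphExcess a b c) ≤ Real.cos (π / 5) :=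
    Real.cos_le_cos_of_nonneg_of_le_pi (by positivity) (by linarith [pi_pos]) hge
  linarith

/-- `n (n − 1) ≤ 6` for `n ≤ 3` (flags in a triangle). [folklore] -/
theorem ffrC5I_offDiag_le {n : ℕ} (h : n ≤ 3) : n * n - n ≤ 6 := by
  interval_cases n <;> norm_num

/-! ### The registered sub-goal -/

/-- **No gapped twelve-shell has all shell-degrees five** (icosahedron kill of the capped
census).  See the module docstring: fan triangulation of the radial projection, bonds are hull
edges, flag double count forces all twenty fan triangles to be bonded, each bonded spherical
triangle has excess `< π/5`, contradicting total area `4π` (node equation). [folklore] -/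
theorem stub_ffrC5NoIcos :
    ∀ t : Fin 12 → EuclideanSpace ℝ (Fin 3),
        (∀ k, 1 - 1 / 50 ≤ ‖t k‖ ∧ ‖t k‖ ≤ 1 + 1 / 50) →
        (∀ k l, k ≠ l → 1 - 1 / 50 ≤ dist (t k) (t l) ∧ (dist (t k) (t l) ≤ 1 + 1 / 50 ∨ 63 / 50 ≤ dist (t k) (t l))) →
        (∀ k, (Finset.univ.filter fun l => l ≠ k ∧ dist (t k) (t l) ≤ 1 + 1 / 50).card = 5) → False := by
  intro t hn hd h5
  -- the normalised shell (an opaque `u` with its defining equation used once)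
  obtain ⟨u, hu⟩ : ∃ u : Fin 12 → EuclideanSpace ℝ (Fin 3), u = fun k => ‖t k‖⁻¹ • t k := ⟨_, rfl⟩
  have hu1 : ∀ k, ‖u k‖ = 1 := fun k => by rw [hu]; exact ffrC5_norm_normalize (hn k)
  have huinj : Function.Injective u := by rw [hu]; exact ffrC5_normalize_injective t hn hd
  have hhi : ∀ k l, k ≠ l → ⟪u k, u l⟫ ≤ 2801 / 5202 := fun k l hkl => by
    rw [hu]; exact ffrC5_inner_normalize_le (hn k) (hn l) (hd k l hkl).1
  have hlo : ∀ k l, dist (t k) (t l) ≤ 1 + 1 / 50 → 2201 / 4802 ≤ ⟪u k, u l⟫ := fun k l h => by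
    rw [hu]; exact ffrC5_le_inner_normalize (hn k) (hn l) h
  have h0u : (0 : EuclideanSpace ℝ (Fin 3)) ∈ interior (convexHull ℝ (Set.range u)) := by
    rw [hu]; exact stub_ffrC5Interior t hn hd (fun k => by rw [h5 k]; norm_num)
  clear hu
  obtain ⟨X, hX⟩ : ∃ X : Finset (EuclideanSpace ℝ (Fin 3)), X = Finset.univ.image u := ⟨_, rfl⟩
  have hX1 : ∀ y ∈ X, ‖y‖ = 1 := by
    intro y hy
    rw [hX] at hy
    obtain ⟨k, -, rfl⟩ := Finset.mem_image.1 hy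
    exact hu1 k
  have hXcard : X.card = 12 := by
    rw [hX, Finset.card_image_of_injective _ huinj, Finset.card_univ, Fintype.card_fin]
  have hmemX : ∀ k, u k ∈ X := fun k => by rw [hX]; exact Finset.mem_image_of_mem u (Finset.mem_univ k)
  have hXu : ∀ y ∈ X, ∃ k, u k = y := fun y hy => by
    rw [hX] at hy
    obtain ⟨k, -, hk⟩ := Finset.mem_image.1 hy
    exact ⟨k, hk⟩
  have h0 : (0 : EuclideanSpace ℝ (Fin 3)) ∈ interior (convexHull ℝ (X : Set (EuclideanSpace ℝ (Fin 3)))) := by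
    have hXs : (X : Set (EuclideanSpace ℝ (Fin 3))) = Set.range u := by
      rw [hX, Finset.coe_image, Finset.coe_univ, Set.image_univ]
    rw [hXs]
    exact h0u
  clear hX
  -- bonds are hull edges, hence sides of exactly two fan triangles
  have hFcard : (fanTriSets X).card = 20 := card_fanTriSets hXcard hX1 h0
  have hedge : ∀ k l, l ≠ k → dist (t k) (t l) ≤ 1 + 1 / 50 →
      ((fanTriSets X).filter fun T => u k ∈ T ∧ u l ∈ T).card = 2 := by
    intro k l hkl hb
    have hmem : ({u k, u l} : Finset (EuclideanSpace ℝ (Fin 3))) ∈ hullEdges X := by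
      refine stub_bondHullEdge X hX1 (u k) (u l) (hmemX k) (hmemX l) (huinj.ne hkl.symm) ?_ ?_
      · linarith [hlo k l hb]
      · intro y hy hyk hyl
        obtain ⟨m, rfl⟩ := hXu y hy
        have hmk : m ≠ k := fun h => hyk (by rw [h])
        have hml : m ≠ l := fun h => hyl (by rw [h])
        have h1 := hhi k m hmk.symm
        have h2 := hhi l m hml.symm
        have h3 := hlo k l hb
        linarith
    have h2 := card_filter_fanTriSets_eq_two_of_mem_hullEdges hX1 h0 hmem
    have hEqF : ((fanTriSets X).filter fun T => u k ∈ T ∧ u l ∈ T) =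
        (fanTriSets X).filter fun T => ({u k, u l} : Finset (EuclideanSpace ℝ (Fin 3))) ⊆ T := by
      ext T
      simp only [Finset.mem_filter, Finset.insert_subset_iff, Finset.singleton_subset_iff]
    rw [hEqF]
    exact h2
  -- the ordered bonds: sixty of them
  obtain ⟨B, hB⟩ : ∃ B : Finset (Fin 12 × Fin 12),
      B = Finset.univ.filter fun p => p.2 ≠ p.1 ∧ dist (t p.1) (t p.2) ≤ 1 + 1 / 50 := ⟨_, rfl⟩
  have hBcard : B.card = 60 := by
    have h1 : B.card = ∑ k : Fin 12,
        (Finset.univ.filter fun l => l ≠ k ∧ dist (t k) (t l) ≤ 1 + 1 / 50).card := by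
      rw [hB, Finset.card_filter, ← Finset.univ_product_univ, Finset.sum_product]
      refine Finset.sum_congr rfl fun k _ => ?_
      rw [Finset.card_filter]
    rw [h1, Finset.sum_congr rfl fun k _ => h5 k, Finset.sum_const, Finset.card_univ,
      Fintype.card_fin, smul_eq_mul]
  have hmemB : ∀ p : Fin 12 × Fin 12, p ∈ B ↔ p.2 ≠ p.1 ∧ dist (t p.1) (t p.2) ≤ 1 + 1 / 50 := by
    intro p
    rw [hB, Finset.mem_filter]
    exact ⟨fun h => h.2, fun h => ⟨Finset.mem_univ _, h⟩⟩
  clear hB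
  -- double count of the flags (triangle, ordered bond inside it)
  have hQ120 : ∑ T ∈ fanTriSets X, (B.filter fun p => u p.1 ∈ T ∧ u p.2 ∈ T).card = 120 := by
    have h1 : ∑ T ∈ fanTriSets X, (B.filter fun p => u p.1 ∈ T ∧ u p.2 ∈ T).card =
        ∑ T ∈ fanTriSets X, ∑ p ∈ B, if (u p.1 ∈ T ∧ u p.2 ∈ T) then 1 else 0 := by
      refine Finset.sum_congr rfl fun T _ => ?_
      rw [Finset.card_filter]
    rw [h1, Finset.sum_comm]
    have h2 : ∀ p ∈ B, (∑ T ∈ fanTriSets X, if (u p.1 ∈ T ∧ u p.2 ∈ T) then 1 else 0) = 2 := by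
      intro p hp
      rw [hmemB] at hp
      rw [← Finset.card_filter]
      exact hedge p.1 p.2 hp.1 hp.2
    rw [Finset.sum_congr rfl h2, Finset.sum_const, smul_eq_mul, hBcard]
  -- each triangle carries at most six flags; hence exactly six: every triangle is bonded
  have hoff : ∀ T ∈ fanTriSets X,
      (B.filter fun p => u p.1 ∈ T ∧ u p.2 ∈ T) ⊆ (Finset.univ.filter fun k => u k ∈ T).offDiag ∧
        (Finset.univ.filter fun k => u k ∈ T).offDiag.card ≤ 6 := by
    intro T hT
    have hScard : (Finset.univ.filter fun k => u k ∈ T).card ≤ 3 := by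
      have h1 : ((Finset.univ.filter fun k => u k ∈ T).image u).card =
          (Finset.univ.filter fun k => u k ∈ T).card := Finset.card_image_of_injective _ huinj
      have h2 : (Finset.univ.filter fun k => u k ∈ T).image u ⊆ T := by
        intro y hy
        obtain ⟨k, hk, rfl⟩ := Finset.mem_image.1 hy
        exact (Finset.mem_filter.1 hk).2
      calc (Finset.univ.filter fun k => u k ∈ T).card
          = ((Finset.univ.filter fun k => u k ∈ T).image u).card := h1.symm
        _ ≤ T.card := Finset.card_le_card h2
        _ = 3 := card_eq_three_of_mem_fanTriSets hX1 hT
    refine ⟨fun p hp => ?_, ?_⟩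
    · rw [Finset.mem_filter, hmemB] at hp
      rw [Finset.mem_offDiag, Finset.mem_filter, Finset.mem_filter]
      exact ⟨⟨Finset.mem_univ _, hp.2.1⟩, ⟨Finset.mem_univ _, hp.2.2⟩, hp.1.1.symm⟩
    · rw [Finset.offDiag_card]
      exact ffrC5I_offDiag_le hScard
  have hle6 : ∀ T ∈ fanTriSets X, (B.filter fun p => u p.1 ∈ T ∧ u p.2 ∈ T).card ≤ 6 := fun T hT =>
    (Finset.card_le_card (hoff T hT).1).trans (hoff T hT).2
  have heq6 : ∀ T ∈ fanTriSets X, (B.filter fun p => u p.1 ∈ T ∧ u p.2 ∈ T).card = 6 := by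
    by_contra hcon
    push Not at hcon
    obtain ⟨T₀, hT₀, hT₀'⟩ := hcon
    have hlt : (B.filter fun p => u p.1 ∈ T₀ ∧ u p.2 ∈ T₀).card < 6 :=
      lt_of_le_of_ne (hle6 T₀ hT₀) hT₀'
    have h := Finset.sum_lt_sum hle6 ⟨T₀, hT₀, hlt⟩
    rw [Finset.sum_const, smul_eq_mul, hFcard, hQ120] at h
    omega
  have hbond : ∀ T ∈ fanTriSets X, ∀ k l, l ≠ k → u k ∈ T → u l ∈ T →
      dist (t k) (t l) ≤ 1 + 1 / 50 := by
    intro T hT k l hkl hk hl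
    have hEq : (B.filter fun p => u p.1 ∈ T ∧ u p.2 ∈ T) =
        (Finset.univ.filter fun k => u k ∈ T).offDiag :=
      Finset.eq_of_subset_of_card_le (hoff T hT).1 (by rw [heq6 T hT]; exact (hoff T hT).2)
    have hmem : (k, l) ∈ (Finset.univ.filter fun k => u k ∈ T).offDiag := by
      rw [Finset.mem_offDiag, Finset.mem_filter, Finset.mem_filter]
      exact ⟨⟨Finset.mem_univ _, hk⟩, ⟨Finset.mem_univ _, hl⟩, hkl.symm⟩
    rw [← hEq, Finset.mem_filter, hmemB] at hmem
    exact hmem.1.2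
  -- the angle sum of one fan triangle is `< π + π/5`
  have htri : ∀ T ∈ fanTriSets X, ∑ y ∈ X, triAngleAt X T y < π + π / 5 := by
    intro T hT
    have hT3 := card_eq_three_of_mem_fanTriSets hX1 hT
    obtain ⟨a, b, c, hab, hac, hbc, rfl⟩ := Finset.card_eq_three.1 hT3
    have hsubX := subset_of_mem_fanTriSets hX1 hT
    have haX : a ∈ X := hsubX (by simp)
    have hbX : b ∈ X := hsubX (by simp)
    have hcX : c ∈ X := hsubX (by simp)
    obtain ⟨i, rfl⟩ := hXu a haX
    obtain ⟨j, rfl⟩ := hXu b hbX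
    obtain ⟨k, rfl⟩ := hXu c hcX
    have hij : j ≠ i := fun h => hab (by rw [h])
    have hik : k ≠ i := fun h => hac (by rw [h])
    have hjk : k ≠ j := fun h => hbc (by rw [h])
    -- the three sides are bonds
    have bij := hbond _ hT i j hij (by simp) (by simp)
    have bik := hbond _ hT i k hik (by simp) (by simp)
    have bjk := hbond _ hT j k hjk (by simp) (by simp)
    have wij : 2201 / 4802 ≤ ⟪u i, u j⟫ ∧ ⟪u i, u j⟫ ≤ 2801 / 5202 := ⟨hlo i j bij, hhi i j hij.symm⟩
    have wik : 2201 / 4802 ≤ ⟪u i, u k⟫ ∧ ⟪u i, u k⟫ ≤ 2801 / 5202 := ⟨hlo i k bik, hhi i k hik.symm⟩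
    have wjk : 2201 / 4802 ≤ ⟪u j, u k⟫ ∧ ⟪u j, u k⟫ ≤ 2801 / 5202 := ⟨hlo j k bjk, hhi j k hjk.symm⟩
    have hE := ffrC5I_sphExcess_lt (hu1 i) (hu1 j) (hu1 k) wij wik wjk
    -- the sum over `X` is the sum of the three corners
    have hsum : ∑ y ∈ X, triAngleAt X {u i, u j, u k} y =
        ∑ y ∈ ({u i, u j, u k} : Finset _), triAngleAt X {u i, u j, u k} y := by
      symm
      refine Finset.sum_subset hsubX fun y _ hy => triAngleAt_eq_zero_of_not_mem hy
    rw [hsum, Finset.sum_insert (by simp [hab, hac]), Finset.sum_insert (by simp [hbc]),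
      Finset.sum_singleton]
    have e1 : triAngleAt X {u i, u j, u k} (u i) = angle (perpTo (u i) (u j)) (perpTo (u i) (u k)) :=
      triAngleAt_eq_angle hX1 hT hab hac
    have p2 : ({u i, u j, u k} : Finset (EuclideanSpace ℝ (Fin 3))) = {u j, u i, u k} :=
      Finset.insert_comm _ _ _
    have p3 : ({u i, u j, u k} : Finset (EuclideanSpace ℝ (Fin 3))) = {u k, u i, u j} := by
      rw [Finset.insert_comm (u i) (u j), Finset.pair_comm (u i) (u k), Finset.insert_comm (u j) (u k),
        Finset.pair_comm (u j) (u i)]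
    have hT2 : ({u j, u i, u k} : Finset (EuclideanSpace ℝ (Fin 3))) ∈ fanTriSets X := p2 ▸ hT
    have hT3' : ({u k, u i, u j} : Finset (EuclideanSpace ℝ (Fin 3))) ∈ fanTriSets X := p3 ▸ hT
    have e2 : triAngleAt X {u j, u i, u k} (u j) = angle (perpTo (u j) (u i)) (perpTo (u j) (u k)) :=
      triAngleAt_eq_angle hX1 hT2 hab.symm hbc
    have e3 : triAngleAt X {u k, u i, u j} (u k) = angle (perpTo (u k) (u i)) (perpTo (u k) (u j)) :=
      triAngleAt_eq_angle hX1 hT3' hac.symm hbc.symm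
    rw [← p2] at e2
    rw [← p3] at e3
    rw [e1, e2, e3]
    rw [sphExcess_def] at hE
    linarith
  -- the node equation summed over the twelve directions
  have htot : ∑ y ∈ X, ∑ T ∈ fanTriSets X, triAngleAt X T y = 24 * π := by
    rw [Finset.sum_congr rfl fun y hy => sum_triAngleAt hX1 h0 hy, Finset.sum_const, hXcard]
    simp only [nsmul_eq_mul]
    push_cast
    ring
  rw [Finset.sum_comm] at htot
  have hFne : (fanTriSets X).Nonempty := by rw [← Finset.card_pos, hFcard]; norm_num
  have hlt : ∑ T ∈ fanTriSets X, ∑ y ∈ X, triAngleAt X T y < ∑ T ∈ fanTriSets X, (π + π / 5) :=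
    Finset.sum_lt_sum_of_nonempty hFne htri
  rw [htot, Finset.sum_const, hFcard] at hlt
  simp only [nsmul_eq_mul] at hlt
  push_cast at hlt
  linarith

end Summit.AtomisticToContinuum.Crystallization.Theorems

end
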